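import Literature.NumberTheory.EllipticCurves.ZpExtensionScalarTwist
import Mathlib.GroupTheory.FiniteAbelian.Basic
import HarnessLib

/-!
# Finiteness of Howard's specialised modules `M ⊗ A_{m,k}(ψ)`: pure-tensor identities on the pinned carrier,
# generation, `#(M ⊗ A_{m,k}) ≤ #A_{m,k}^r`, and `Finite (M ⊗ A_{m,k})` for finite `M` (proofs file)

Topic `NumberTheory/EllipticCurves` (companion of `ZpExtensionScalarTwist`). THEOREMS ONLY (no definition, no
named fact, no instance, no `sorry`), about the carrier `IwasawaAlgebra.EisensteinCoeff.Twisted p m k M`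
(`= A_{m,k} ⊗_ℤ M`, `A_{m,k} = Λ/(T^m + p, p^k)`, the underlying group of `T_𝔮/p^k T_𝔮 = E[p^k] ⊗ A_{m,k}(ψ)`
for `M = E[p^k]` [Howard 2004, §2.2, proof of Thm. 2.2.10 at `𝔮 = T^m + p`]) stated through its PINNED
pure tensors `Twisted.tmul` (so that no user ever meets the unpinned `ℤ`-algebra structure of `A_{m,k}`):

* §1 the bilinearity identities `Twisted.tmul_add`, `add_tmul`, `tmul_zero`, `zero_tmul`, `tmul_neg`, `tmul_sub`,
  `tmul_nsmul`, `tmul_zsmul`, `tmul_eq_smul_tmul_one` (`c ⊗ a = c • (1 ⊗ a)`);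
* §2 generation: `closure_range_tmul_eq_top` (as a group `M ⊗ A_{m,k}` is generated by the pure tensors),
  `span_image_tmul_one_eq_top` (`span_ℤ S = M ⟹ span_{A_{m,k}} {1 ⊗ s} = M ⊗ A_{m,k}`),
  `moduleFinite_twisted` (`M` finitely generated ⟹ `M ⊗ A_{m,k}` finitely generated over `A_{m,k}`);
* §3 counting: `isOfFinAddOrder_twisted` (every element is killed by `p^k`), **`finite_twisted`** (`M` finite,
  `m ≥ 1` ⟹ `M ⊗ A_{m,k}` finite: finitely generated torsion abelian group), and
  **`natCard_twisted_le_pow`**: if `M` is generated by `r` elements then `#(M ⊗ A_{m,k}) ≤ #A_{m,k}^r = p^{kmr}`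
  (tree `card_quotient_span_qm_sup_span_C_pow`) — for `M = E[p^k]` (`r = 2`): `#(T_𝔮/p^k T_𝔮) ≤ p^{2km}`.

WHY. The cardinality currency of the control theorem at `𝔮 = q_m` (cell `pub/bsd-print-x9`, D1/S1 road of the
shared μ-residual; `SpecWitness.card_coker_le` / `card_ker_le`): every error group is a subquotient of some
`H^i(G, M_v ⊗ A_{m,k}(ψ))` with `M_v` finite on `r` generators, whose size is bounded through §3 and the tree's
`IwasawaAlgebra.nat_card_torsionBy_X_pow_le_pow_mul` family. Pure algebra; nothing about Galois cohomology is
asserted. BSD is not proved by any of this.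

References: [Howard2004HeegnerKolyvagin] B. Howard, Compositio Math. 140 (2004), §2.2, Lemma 2.2.7, Prop. 2.2.8,
proof of Thm. 2.2.10; [Washington1997] §13.2.
-/

noncomputable section

open scoped Classical

universe w

namespace Literature.NumberTheory.EllipticCurves.IwasawaAlgebra.EisensteinCoeff

open Literature.NumberTheory.GaloisRepresentations

variable {p : ℕ} [hp : Fact p.Prime] {m k : ℕ} {M : Type w} [AddCommGroup M]

/-! ## §1 Bilinearity of the pinned pure tensors -/

/-- `c ⊗ (a + b) = c ⊗ a + c ⊗ b`. [cite: Howard2004HeegnerKolyvagin, §2.2 (T_𝔮 = 𝐓 ⊗_Λ S_𝔮)] -/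
theorem Twisted.tmul_add (c : EisensteinCoeff p m k) (a b : M) :
    (Twisted.tmul c (a + b) : Twisted p m k M) = Twisted.tmul c a + Twisted.tmul c b :=
  TensorProduct.tmul_add c a b

/-- `(c + c') ⊗ a = c ⊗ a + c' ⊗ a`. [cite: Howard2004HeegnerKolyvagin, §2.2 (T_𝔮 = 𝐓 ⊗_Λ S_𝔮)] -/
theorem Twisted.add_tmul (c c' : EisensteinCoeff p m k) (a : M) :
    (Twisted.tmul (c + c') a : Twisted p m k M) = Twisted.tmul c a + Twisted.tmul c' a :=
  TensorProduct.add_tmul c c' a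

/-- `c ⊗ 0 = 0`. [cite: Howard2004HeegnerKolyvagin, §2.2 (T_𝔮 = 𝐓 ⊗_Λ S_𝔮)] -/
@[simp]
theorem Twisted.tmul_zero (c : EisensteinCoeff p m k) : (Twisted.tmul c (0 : M) : Twisted p m k M) = 0 :=
  TensorProduct.tmul_zero M c

/-- `0 ⊗ a = 0`. [cite: Howard2004HeegnerKolyvagin, §2.2 (T_𝔮 = 𝐓 ⊗_Λ S_𝔮)] -/
@[simp]
theorem Twisted.zero_tmul (a : M) : (Twisted.tmul (0 : EisensteinCoeff p m k) a : Twisted p m k M) = 0 :=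
  TensorProduct.zero_tmul _ a

/-- `c ⊗ (−a) = −(c ⊗ a)`. [cite: Howard2004HeegnerKolyvagin, §2.2 (T_𝔮 = 𝐓 ⊗_Λ S_𝔮)] -/
theorem Twisted.tmul_neg (c : EisensteinCoeff p m k) (a : M) :
    (Twisted.tmul c (-a) : Twisted p m k M) = -Twisted.tmul c a :=
  TensorProduct.tmul_neg c a

/-- `c ⊗ (a − b) = c ⊗ a − c ⊗ b`. [cite: Howard2004HeegnerKolyvagin, §2.2 (T_𝔮 = 𝐓 ⊗_Λ S_𝔮)] -/
theorem Twisted.tmul_sub (c : EisensteinCoeff p m k) (a b : M) :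
    (Twisted.tmul c (a - b) : Twisted p m k M) = Twisted.tmul c a - Twisted.tmul c b :=
  TensorProduct.tmul_sub c a b

/-- `c ⊗ (n • a) = n • (c ⊗ a)` for `n : ℕ`. [cite: Howard2004HeegnerKolyvagin, §2.2 (T_𝔮 = 𝐓 ⊗_Λ S_𝔮)] -/
theorem Twisted.tmul_nsmul (c : EisensteinCoeff p m k) (n : ℕ) (a : M) :
    (Twisted.tmul c (n • a) : Twisted p m k M) = n • Twisted.tmul c a :=
  map_nsmul (AddMonoidHom.mk' (fun a : M ↦ (Twisted.tmul c a : Twisted p m k M)) (Twisted.tmul_add c)) n a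

/-- `c ⊗ (n • a) = n • (c ⊗ a)` for `n : ℤ`. [cite: Howard2004HeegnerKolyvagin, §2.2 (T_𝔮 = 𝐓 ⊗_Λ S_𝔮)] -/
theorem Twisted.tmul_zsmul (c : EisensteinCoeff p m k) (n : ℤ) (a : M) :
    (Twisted.tmul c (n • a) : Twisted p m k M) = n • Twisted.tmul c a :=
  map_zsmul (AddMonoidHom.mk' (fun a : M ↦ (Twisted.tmul c a : Twisted p m k M)) (Twisted.tmul_add c)) n a

/-- `c ⊗ a = c • (1 ⊗ a)`. [cite: Howard2004HeegnerKolyvagin, §2.2 (T_𝔮 = 𝐓 ⊗_Λ S_𝔮)] -/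
theorem Twisted.tmul_eq_smul_tmul_one (c : EisensteinCoeff p m k) (a : M) :
    (Twisted.tmul c a : Twisted p m k M) = c • Twisted.tmul 1 a := by
  rw [Twisted.smul_tmul, mul_one]

/-! ## §2 Generation -/

/-- **As an additive group, `M ⊗ A_{m,k}` is generated by the pure tensors.**
[cite: Howard2004HeegnerKolyvagin, §2.2 (T_𝔮 = 𝐓 ⊗_Λ S_𝔮)] -/
theorem closure_range_tmul_eq_top :
    AddSubgroup.closure (Set.range fun ca : EisensteinCoeff p m k × M ↦ (Twisted.tmul ca.1 ca.2 : Twisted p m k M)) =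
      ⊤ := by
  rw [eq_top_iff]
  rintro x -
  induction x using Twisted.induction_on with
  | zero => exact zero_mem _
  | tmul c a => exact AddSubgroup.subset_closure ⟨(c, a), rfl⟩
  | add x y hx hy => exact add_mem hx hy

/-- **Generators transfer**: if `S` spans `M` over `ℤ` then the pure tensors `1 ⊗ s`, `s ∈ S`, span
`M ⊗ A_{m,k}` over `A_{m,k}`. [cite: Howard2004HeegnerKolyvagin, §2.2 (T_𝔮 = 𝐓 ⊗_Λ S_𝔮)] -/
theorem span_image_tmul_one_eq_top {S : Set M} (hS : Submodule.span ℤ S = ⊤) :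
    Submodule.span (EisensteinCoeff p m k) ((fun s : M ↦ (Twisted.tmul 1 s : Twisted p m k M)) '' S) = ⊤ := by
  set N : Submodule (EisensteinCoeff p m k) (Twisted p m k M) :=
    Submodule.span (EisensteinCoeff p m k) ((fun s : M ↦ (Twisted.tmul 1 s : Twisted p m k M)) '' S) with hN
  -- every `1 ⊗ a` lies in `N`
  have h1 : ∀ a : M, (Twisted.tmul 1 a : Twisted p m k M) ∈ N := by
    intro a
    have ha : a ∈ Submodule.span ℤ S := by rw [hS]; exact Submodule.mem_top
    induction ha using Submodule.span_induction with
    | mem s hs => exact Submodule.subset_span ⟨s, hs, rfl⟩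
    | zero => rw [Twisted.tmul_zero]; exact zero_mem _
    | add a b _ _ ha hb => rw [Twisted.tmul_add]; exact add_mem ha hb
    | smul n a _ ha => rw [Twisted.tmul_zsmul]; exact N.toAddSubgroup.zsmul_mem ha n
  rw [eq_top_iff]
  rintro x -
  induction x using Twisted.induction_on with
  | zero => exact zero_mem _
  | tmul c a => rw [Twisted.tmul_eq_smul_tmul_one]; exact N.smul_mem c (h1 a)
  | add x y hx hy => exact add_mem hx hy

/-- **`M ⊗ A_{m,k}` is finitely generated over `A_{m,k}` when `M` is finitely generated** (over `ℤ`).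
[cite: Howard2004HeegnerKolyvagin, §2.2 (T_𝔮 = 𝐓 ⊗_Λ S_𝔮)] -/
theorem moduleFinite_twisted [Module.Finite ℤ M] : Module.Finite (EisensteinCoeff p m k) (Twisted p m k M) := by
  obtain ⟨S, hS⟩ := Module.Finite.fg_top (R := ℤ) (M := M)
  refine ⟨⟨S.image fun s : M ↦ (Twisted.tmul 1 s : Twisted p m k M), ?_⟩⟩
  rw [Finset.coe_image]
  exact span_image_tmul_one_eq_top hS

/-! ## §3 Counting -/

/-- Every element of `M ⊗ A_{m,k}` is killed by `p^k` (as a natural-number multiple).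
[cite: Howard2004HeegnerKolyvagin, §2.2] -/
theorem prime_pow_nsmul_twisted (x : Twisted p m k M) : (p ^ k) • x = 0 := by
  have h := natCast_pow_smul_eq_zero (p := p) m k x
  rwa [← natCast_zsmul, Nat.cast_pow]

/-- Every element of `M ⊗ A_{m,k}` has finite additive order (dividing `p^k`). [cite: Howard2004HeegnerKolyvagin, §2.2] -/
theorem isOfFinAddOrder_twisted (x : Twisted p m k M) : IsOfFinAddOrder x :=
  isOfFinAddOrder_iff_nsmul_eq_zero.mpr ⟨p ^ k, pow_pos hp.out.pos k, prime_pow_nsmul_twisted x⟩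

/-- **`M ⊗ A_{m,k}` is FINITE for finite `M`** (`m ≥ 1`): a finitely generated (by the finitely many pure
tensors) torsion abelian group. For `M = E[p^k]`: `T_𝔮/p^k T_𝔮` is finite.
[cite: Howard2004HeegnerKolyvagin, §2.2 and Lemma 2.2.7] -/
theorem finite_twisted [Finite M] (hm : 1 ≤ m) : Finite (Twisted p m k M) := by
  haveI := finite_quotient_span_qm_sup_span_C_pow p hm k
  haveI : AddGroup.FG (Twisted p m k M) := by
    rw [AddGroup.fg_iff]
    exact ⟨_, closure_range_tmul_eq_top, Set.finite_range _⟩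
  exact AddCommGroup.finite_of_fg_torsion _ isOfFinAddOrder_twisted

/-- **`#(M ⊗ A_{m,k}) ≤ #A_{m,k}^r` when `M` is generated by `r` elements** (over `ℤ`; `m ≥ 1`), and
`#A_{m,k} = p^{km}`: so `#(M ⊗ A_{m,k}) ≤ p^{kmr}`; for `M = E[p^k]`, `r = 2`: `#(T_𝔮/p^k T_𝔮) ≤ p^{2km}`.
[cite: Howard2004HeegnerKolyvagin, §2.2 and proof of Thm. 2.2.10 (𝔮 = T^m + p)] [cite: Washington1997, §13.2] -/
theorem natCard_twisted_le_pow (hm : 1 ≤ m) {r : ℕ} (g : Fin r → M)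
    (hg : Submodule.span ℤ (Set.range g) = ⊤) : Nat.card (Twisted p m k M) ≤ p ^ (k * m * r) := by
  haveI := finite_quotient_span_qm_sup_span_C_pow p hm k
  -- the `A_{m,k}`-linear map `(Fin r → A_{m,k}) → M ⊗ A_{m,k}`, `c ↦ ∑ c_i • (1 ⊗ g_i)`, is onto
  let φ : (Fin r → EisensteinCoeff p m k) →ₗ[EisensteinCoeff p m k] Twisted p m k M :=
    Fintype.linearCombination (EisensteinCoeff p m k) fun i ↦ (Twisted.tmul 1 (g i) : Twisted p m k M)
  have hφ : Function.Surjective φ := by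
    rw [← LinearMap.range_eq_top, Fintype.range_linearCombination]
    have h := span_image_tmul_one_eq_top (p := p) (m := m) (k := k) hg
    rwa [← Set.range_comp] at h
  calc Nat.card (Twisted p m k M) ≤ Nat.card (Fin r → EisensteinCoeff p m k) :=
        Nat.card_le_card_of_surjective φ hφ
    _ = p ^ (k * m * r) := by
        rw [Nat.card_pi, Finset.prod_const, Finset.card_univ, Fintype.card_fin,
          card_quotient_span_qm_sup_span_C_pow p hm k, ← pow_mul]

end Literature.NumberTheory.EllipticCurves.IwasawaAlgebra.EisensteinCoeff

end
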